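import Summits.ResolutionOfSingularities.ResolutionOfSingularities.Theorems.PurelyInseparableDim4Target
import Literature.AlgebraicGeometry.Resolution.CentreBlowupOrdAlongBasics
import HarnessLib
import HarnessLib.Audit.Tags

/-!
# Purely inseparable fourfolds — `q`-TH-POWER FACTORS PASS THROUGH THE CLEANING, the singleton chart divides by
# `x_j^q`, and equimultiplicity at `q = 2` reads the linear coefficients (cell res-dim4-pi; kit for the D3b plan)
# [OURS · counted 0 · bookkeeping identities of OUR frame, not about resolution]

Width seat `res-dim4-p-10` (g2).  Three small identities that the paper proof `HOME/res-dim4-p-10/D3b-PAPER.md` («pure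
leaves win the global game over `𝔽₂`») uses at every step and that the tree did not have in this generality:

* **`deletePthPowers_mul_of_forall_dvd`** — if every monomial of `P` is a `q`-th power (all exponents divisible by `q`),
  then `deletePthPowers q (P * Q) = P * deletePthPowers q Q`: square (resp. `q`-th power) factors `Θ` are INERT under the
  cleaning — the «`Θ·L`» states of the paper keep their `Θ`;
* **`chartTransform_singleton_mul`** — the chart of the SINGLETON centre `{j}` divides by `x_j^q`:
  `chartTransform q {j} j (X j ^ q * G) = G` (every index type, every `q`);
* **`isEquimultiplePoint_two_iff`** — at `q = 2` a point is equimultiple iff every LINEAR coefficient of the transform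
  vanishes.

Any commutative ring / field as stated; nothing here proves resolution of singularities in dimension ≥ 4 /
characteristic `p`; counted 0; AI work, weaker than expert review. bears_on: LADDER-RESOLUTION:D157-DOOR2 (res-dim4-pi ·
WORD #60 D3b kit). Supports stmt-ResolutionOfSingularities-16155 (helper).
-/

set_option linter.dupNamespace false

open MvPolynomial Finset

open scoped BigOperators

noncomputable section

namespace Summit.ResolutionOfSingularities.ResolutionOfSingularities.Theorems.PIDim4

namespace PthPowerFactor

open Literature.AlgebraicGeometry.Resolution
open Literature.AlgebraicGeometry.Resolution.Hauser2010
open CentreBlowup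

variable {σ : Type*} [DecidableEq σ] {K : Type*} [CommRing K]

/-! ## 1. `q`-th-power factors are inert under the cleaning -/

omit [DecidableEq σ] in
/-- If `u` is a `q`-th power exponent then `u + e` is one iff `e` is. [folklore] -/
theorem isPthPowerExponent_add_iff (q : ℕ) {u e : σ →₀ ℕ} (hu : ∀ i, q ∣ u i) :
    IsPthPowerExponent q (u + e) ↔ IsPthPowerExponent q e := by
  rw [isPthPowerExponent_iff, isPthPowerExponent_iff]
  refine ⟨fun h i => ?_, fun h i => ?_⟩
  · have := h i
    rw [Finsupp.add_apply] at this
    exact (Nat.dvd_add_right (hu i)).mp this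
  · rw [Finsupp.add_apply]
    exact dvd_add (hu i) (h i)

/-- **`q`-th-power factors pass through the cleaning.** If every monomial of `P` has all exponents divisible by
`q`, then `deletePthPowers q (P * Q) = P * deletePthPowers q Q`. [folklore] -/
theorem deletePthPowers_mul_of_forall_dvd (q : ℕ) (P Q : MvPolynomial σ K)
    (hP : ∀ u ∈ P.support, ∀ i, q ∣ u i) :
    deletePthPowers q (P * Q) = P * deletePthPowers q Q := by
  ext d
  rw [coeff_deletePthPowers, coeff_mul, coeff_mul]
  by_cases hd : IsPthPowerExponent q d
  · -- a `q`-th power monomial of `P * Q` only comes from `q`-th power monomials of `Q`, which are deleted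
    rw [if_pos hd]
    symm
    refine Finset.sum_eq_zero fun x hx => ?_
    by_cases hxP : x.1 ∈ P.support
    · have hsum : x.1 + x.2 = d := Finset.mem_antidiagonal.mp hx
      have he : IsPthPowerExponent q x.2 := by
        rw [← isPthPowerExponent_add_iff q (hP x.1 hxP), hsum]; exact hd
      rw [coeff_deletePthPowers, if_pos he, mul_zero]
    · rw [MvPolynomial.notMem_support_iff.mp hxP, zero_mul]
  · -- a non-`q`-th-power monomial of `P * Q` only comes from non-`q`-th-power monomials of `Q`, which are kept
    rw [if_neg hd]
    refine Finset.sum_congr rfl fun x hx => ?_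
    by_cases hxP : x.1 ∈ P.support
    · have hsum : x.1 + x.2 = d := Finset.mem_antidiagonal.mp hx
      have he : ¬ IsPthPowerExponent q x.2 := by
        rw [← isPthPowerExponent_add_iff q (hP x.1 hxP), hsum]; exact hd
      rw [coeff_deletePthPowers, if_neg he]
    · rw [MvPolynomial.notMem_support_iff.mp hxP, zero_mul, zero_mul]

/-- In particular a `q`-th power MONOMIAL passes through the cleaning. [folklore] -/
theorem deletePthPowers_monomial_mul (q : ℕ) {u : σ →₀ ℕ} (hu : ∀ i, q ∣ u i) (c : K)
    (Q : MvPolynomial σ K) :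
    deletePthPowers q (monomial u c * Q) = monomial u c * deletePthPowers q Q := by
  classical
  refine deletePthPowers_mul_of_forall_dvd q _ Q fun v hv i => ?_
  rw [support_monomial] at hv
  split_ifs at hv with hc
  · exact absurd hv (Finset.notMem_empty v)
  · rw [Finset.mem_singleton.mp hv]; exact hu i

/-! ## 2. The singleton chart divides by `x_j^q` -/

/-- The chart exponent of the singleton centre: subtract `q` at `j`. [folklore] -/
theorem chartExponent_singleton (q : ℕ) (j : σ) (d : σ →₀ ℕ) :
    chartExponent q {j} j d = d - Finsupp.single j q := by
  ext i
  rw [chartExponent_apply, degIn_singleton, Finsupp.tsub_apply, Finsupp.single_apply]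
  by_cases hij : i = j
  · subst hij; rw [if_pos rfl, if_pos rfl]
  · rw [if_neg hij, if_neg (Ne.symm hij), Nat.sub_zero]

/-- **The singleton chart divides by `x_j^q`**: `chartTransform q {j} j (X j ^ q * G) = G`. [folklore] -/
theorem chartTransform_singleton_mul (q : ℕ) (j : σ) (G : MvPolynomial σ K) :
    chartTransform q {j} j (X j ^ q * G) = G := by
  classical
  have hXG : X j ^ q * G = ∑ d ∈ G.support, monomial (Finsupp.single j q + d) (coeff d G) := by
    conv_lhs => rw [G.as_sum, Finset.mul_sum]
    refine Finset.sum_congr rfl fun d _ => ?_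
    rw [X_pow_eq_monomial, monomial_mul, one_mul]
  rw [hXG, chartTransform_sum]
  conv_rhs => rw [G.as_sum]
  refine Finset.sum_congr rfl fun d _ => ?_
  rw [chartTransform_monomial, chartExponent_singleton, add_tsub_cancel_left]

/-! ## 3. Equimultiplicity at `q = 2` -/

/-- A non-zero exponent of degree `< 2` is a unit vector. [folklore] -/
theorem eq_single_of_degree_lt_two [Fintype σ] {d : σ →₀ ℕ} (hd : d ≠ 0) (h2 : d.degree < 2) :
    ∃ i, d = Finsupp.single i 1 := by
  classical
  obtain ⟨i, hi⟩ : ∃ i, d i ≠ 0 := by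
    by_contra h
    push Not at h
    exact hd (Finsupp.ext h)
  have hdeg := Finsupp.degree_eq_sum d
  have hi_le : d i ≤ ∑ k, d k := Finset.single_le_sum (fun k _ => Nat.zero_le (d k)) (Finset.mem_univ i)
  have hsplit := Finset.add_sum_erase Finset.univ (⇑d) (Finset.mem_univ i)
  have hdi : d i = 1 := by omega
  have hrest : ∑ k ∈ Finset.univ.erase i, d k = 0 := by omega
  refine ⟨i, Finsupp.ext fun k => ?_⟩
  rw [Finsupp.single_apply]
  by_cases hk : i = k
  · subst hk; rw [if_pos rfl, hdi]
  · rw [if_neg hk]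
    exact Finset.sum_eq_zero_iff.mp hrest k (Finset.mem_erase.mpr ⟨Ne.symm hk, Finset.mem_univ k⟩)

/-- **At `q = 2` a point is equimultiple iff every linear coefficient of the transform vanishes.** [folklore] -/
theorem isEquimultiplePoint_two_iff [Fintype σ] [DecidableEq K] (S : Finset σ) (j : σ) (b : σ → K)
    (s : CState σ K) :
    IsEquimultiplePoint 2 S j b s ↔ ∀ i, coeff (Finsupp.single i 1) (pointTransform 2 S j b s) = 0 := by
  refine ⟨fun h i => h _ (Finsupp.single_ne_zero.mpr one_ne_zero)
    (by rw [Finsupp.degree_single]; exact Nat.one_lt_two), fun h d hd h2 => ?_⟩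
  obtain ⟨i, rfl⟩ := eq_single_of_degree_lt_two hd h2
  exact h i

end PthPowerFactor

end Summit.ResolutionOfSingularities.ResolutionOfSingularities.Theorems.PIDim4

end
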